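import Mathlib
import HarnessLib
import Summits.NavierStokesRegularity.NavierStokesRegularity.Theorems.WakeRatchetMinimalViscousBlowupClosedValve

/-!
# Route `WakeRatchet`, crux `MinimalViscousBlowup` (stmt-NavierStokesRegularity-22743) — LINE g11-1 «threshold ray» (ns-idea-1 g11),
# stub S4 `stub_everyShellFires`: EVERY SHELL FIRES

`everyShellFires` (binders VERBATIM from the skeleton of record; statement identical in v2.2/v2.3/v3.2/v3.3): for a table of the class `E₂(R)` there is
`c₀ = c₀(ε₀) > 0` (`c₀ = 1/(32768 λ^{16})`, `λ = 1+ε₀`) such that every regular trajectory of the NS-scaled `ν`-viscous cascade lattice from a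
one-shell datum that BLOWS UP at `T` (weight-10 norm unbounded) under a critical envelope excites every shell `n ≥ 0` to `λⁿ‖X_n(t)‖² ≥ c₀ν²` at some
`t < T`.  Proof (STUB-PLAN-everyShellFires.md, finite-block form): if shell `n` never fires it is a closed valve (`closedValve_step`, (F2)); the
shells above are then trapped GEOMETRICALLY, `λ^{n+j}‖X_{n+j}‖² ≤ c₀(2λ^{19})^{−j}ν²` (`valve_induction`, (F3): the recursion constant
`16384λ^{−3}c_j ≤ (2λ^{19})^{−1}`), so the weight-20 energies `λ^{20k}‖X_k‖² ≤ λ^{19n}c₀ν²` are bounded above `n`, the envelope bounds the shells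
below `n`, and the weight-10 norm stays bounded — contradicting the blow-up ((F4)).  The envelope constant `C` is used only below shell `n`.
MODEL lattice ODEs only; nothing here concerns the Navier–Stokes equations (no NS regularity statement is proved).
`--supports stmt-NavierStokesRegularity-22743 --as helper`.
[cite: Tao2016AveragedNS, §4 (4.3), Lemma 4.1 (4.5), proof of (4.13); BarbatoMorandinRomito2011, §3.1]
-/

noncomputable section

-- the summit and its single sub-problem share the name (CONVENTIONS §1)
set_option linter.dupNamespace false

open Set Filter Topology

namespace Summit.NavierStokesRegularity.NavierStokesRegularity.Theorems.MinimalViscousBlowup.ThresholdRay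

open Literature.Analysis.FluidPDE Literature.Analysis.FluidPDE.TaoCascade

variable {m : ℕ}

/-! ### §1 From the trajectory clauses to the window form -/

/-- A trajectory `C¹` on `[0,T)` obeying the motion clause (derivative within `[0,∞)`) solves the viscous lattice within every window `[0,T']`,
`T' < T`. [folklore] -/
theorem hasDerivWithinAt_window_of_clauses {ε₀ ν T T' : ℝ} {α : Fin m → Fin m → Fin m → ℤ × ℤ × ℤ → ℝ}
    {X : Fin m → ℤ → ℝ → ℝ} (hcd : ∀ i n, ContDiffOn ℝ 1 (X i n) (Ico 0 T))
    (hmot : ∀ i n t, 0 ≤ t → t < T → derivWithin (X i n) (Ici 0) t =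
      quadTerm ε₀ α X i n t - ν * (1 + ε₀) ^ ((2 : ℝ) * n) * X i n t)
    (hT'T : T' < T) : ∀ (i : Fin m) (k : ℤ), ∀ t ∈ Icc 0 T', HasDerivWithinAt (X i k)
      (quadTerm ε₀ α X i k t - ν * (1 + ε₀) ^ ((2 : ℝ) * k) * X i k t) (Icc 0 T') t := by
  intro i k t ht
  have htT : t < T := lt_of_le_of_lt ht.2 hT'T
  have htI : t ∈ Ico (0 : ℝ) T := ⟨ht.1, htT⟩
  have hd := ((hcd i k).differentiableOn one_ne_zero t htI).hasDerivWithinAt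
  have hset : Ico (0 : ℝ) T = Ici 0 ∩ Iio T := Ici_inter_Iio.symm
  have heq : derivWithin (X i k) (Ico 0 T) t = derivWithin (X i k) (Ici 0) t := by
    rw [hset, derivWithin_inter (Iio_mem_nhds htT)]
  rw [heq, hmot i k t ht.1 htT] at hd
  exact hd.mono fun u hu => ⟨hu.1, lt_of_le_of_lt hu.2 hT'T⟩

/-! ### §2 (F3) The valve induction -/

/-- **(F3) VALVE INDUCTION** (`m = 4`).  `λ = 1+ε₀`, `0 < c₀ ≤ 1/(32768λ^{16})`, a cancelling table with `|α_{··(0,0,1)}| ≤ 1`, a regular trajectory of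
the `ν`-viscous lattice on `[0,T)` from a one-shell datum.  If shell `n ≥ 0` is a closed valve, `λⁿ‖X_n(t)‖² ≤ c₀ν²` on `[0,T)`, then every shell
above is trapped geometrically: `λ^{n+j}‖X_{n+j}(t)‖² ≤ c₀(2λ^{19})^{−j}ν²` on `[0,T)`.
[cite: BarbatoMorandinRomito2011, §3.1; Tao2016AveragedNS, §4 Lemma 4.1 (4.5)] -/
theorem valve_induction {ε₀ ν T c₀ : ℝ} (hε : 0 < ε₀) (hν : 0 < ν) (hT : 0 < T) (hc₀ : 0 < c₀)
    (hc₀le : c₀ ≤ 1 / (32768 * (1 + ε₀) ^ 16))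
    {α : Fin 4 → Fin 4 → Fin 4 → ℤ × ℤ × ℤ → ℝ} (hcan : IsCancellingCoeff α) (hα1 : ∀ i₁ i₂ i₃, |α i₁ i₂ i₃ (0, 0, 1)| ≤ 1)
    {X₀ : Fin 4 → ℝ} {X : Fin 4 → ℤ → ℝ → ℝ}
    (hcd : ∀ i n, ContDiffOn ℝ 1 (X i n) (Ico 0 T))
    (hinit : ∀ i n, X i n 0 = if n = 0 then X₀ i else 0)
    (hmot : ∀ i n t, 0 ≤ t → t < T → derivWithin (X i n) (Ici 0) t =
      quadTerm ε₀ α X i n t - ν * (1 + ε₀) ^ ((2 : ℝ) * n) * X i n t)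
    (hreg : ∀ T' : ℝ, 0 < T' → T' < T → ∃ M : ℝ, ∀ t : ℝ, 0 ≤ t → t ≤ T' →
      ∀ (i : Fin 4) (n : ℤ), (1 + (1 + ε₀) ^ ((10 : ℝ) * n)) * |X i n t| ≤ M)
    (n : ℕ) (hvalve : ∀ t, 0 ≤ t → t < T → (1 + ε₀) ^ n * ‖shellVec X n t‖ ^ 2 ≤ c₀ * ν ^ 2) :
    ∀ (j : ℕ) (t : ℝ), 0 ≤ t → t < T →
      (1 + ε₀) ^ (n + j) * ‖shellVec X ((n + j : ℕ) : ℤ) t‖ ^ 2 ≤ c₀ / (2 * (1 + ε₀) ^ 19) ^ j * ν ^ 2 := by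
  have hl0 : (0 : ℝ) < 1 + ε₀ := by linarith
  have hl1 : (1 : ℝ) ≤ 1 + ε₀ := by linarith
  intro j
  induction j with
  | zero =>
    intro t h0 htT
    simpa using hvalve t h0 htT
  | succ j ih =>
    intro t h0 htT
    -- the window `[0, T']`, `T' = (t+T)/2`
    set T' : ℝ := (t + T) / 2 with hT'
    have hT'0 : 0 < T' := by rw [hT']; linarith
    have htT' : t ≤ T' := by rw [hT']; linarith
    have hT'T : T' < T := by rw [hT']; linarith
    obtain ⟨M₀, hM₀⟩ := hreg T' hT'0 hT'T
    set M : ℝ := max M₀ 0 with hMdef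
    have hM0 : 0 ≤ M := le_max_right _ _
    have hM : ∀ τ ∈ Icc (0 : ℝ) T', ∀ (i : Fin 4) (k : ℤ), (1 + (1 + ε₀) ^ ((10 : ℝ) * k)) * |X i k τ| ≤ M :=
      fun τ hτ i k => (hM₀ τ hτ.1 hτ.2 i k).trans (le_max_left _ _)
    have hder := hasDerivWithinAt_window_of_clauses (ε₀ := ε₀) (ν := ν) hcd hmot hT'T
    -- the current valve constant
    set cj : ℝ := c₀ / (2 * (1 + ε₀) ^ 19) ^ j with hcj
    have hcj0 : 0 < cj := by rw [hcj]; positivity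
    have hcjle : cj ≤ c₀ := by
      rw [hcj]
      exact div_le_self hc₀.le (one_le_pow₀ (by nlinarith [one_le_pow₀ hl1 (n := 19)]))
    have hstep := closedValve_step (m := 4) hε hν hM0 hcj0 hcan hα1 hder hM (n + j)
      (fun i k hk => by rw [hinit]; exact if_neg (by omega)) (fun τ hτ => ih τ hτ.1 (lt_of_le_of_lt hτ.2 hT'T)) t ⟨h0, htT'⟩
    have hidx : (((n + (j + 1) : ℕ)) : ℤ) = ((n + j : ℕ) : ℤ) + 1 := by push_cast; ring
    rw [hidx, show n + (j + 1) = n + j + 1 from rfl]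
    refine hstep.trans ?_
    -- `4·4⁶·cj/λ³ ≤ (2λ^{19})^{-1}` because `cj ≤ c₀ ≤ 1/(32768 λ^{16})`
    have hK : 4 * ((4 : ℕ) : ℝ) ^ 6 * cj / (1 + ε₀) ^ 3 ≤ 1 / (2 * (1 + ε₀) ^ 19) := by
      rw [div_le_div_iff₀ (by positivity) (by positivity)]
      have h1 : cj ≤ 1 / (32768 * (1 + ε₀) ^ 16) := hcjle.trans hc₀le
      have h2 : 4 * ((4 : ℕ) : ℝ) ^ 6 * (1 / (32768 * (1 + ε₀) ^ 16)) * (2 * (1 + ε₀) ^ 19) = 1 * (1 + ε₀) ^ 3 := by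
        field_simp
        ring
      calc 4 * ((4 : ℕ) : ℝ) ^ 6 * cj * (2 * (1 + ε₀) ^ 19)
          ≤ 4 * ((4 : ℕ) : ℝ) ^ 6 * (1 / (32768 * (1 + ε₀) ^ 16)) * (2 * (1 + ε₀) ^ 19) := by gcongr
        _ = 1 * (1 + ε₀) ^ 3 := h2
    calc 4 * ((4 : ℕ) : ℝ) ^ 6 * cj ^ 2 * ν ^ 2 / (1 + ε₀) ^ 3
        = (4 * ((4 : ℕ) : ℝ) ^ 6 * cj / (1 + ε₀) ^ 3) * (cj * ν ^ 2) := by ring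
      _ ≤ (1 / (2 * (1 + ε₀) ^ 19)) * (cj * ν ^ 2) := mul_le_mul_of_nonneg_right hK (by positivity)
      _ = c₀ / (2 * (1 + ε₀) ^ 19) ^ (j + 1) * ν ^ 2 := by
          rw [hcj, pow_succ]
          field_simp
          ring

/-! ### §3 S4: every shell fires -/

/-- **S4 `stub_everyShellFires` (LINE g11-1, binders VERBATIM) — EVERY SHELL FIRES at the structural level `c₀ν²`, `c₀ = 1/(32768(1+ε₀)^{16})`.**
A blow-up at `T` (weight-10 norm unbounded) of a regular trajectory of the NS-scaled `ν`-viscous cascade lattice of a table of the class `E₂(R)`,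
under a critical envelope, excites every shell `n ≥ 0` to `(1+ε₀)ⁿ‖X_n(t)‖² ≥ c₀ν²` at some `t < T`: a shell that never fires is a closed valve,
the shells above it are trapped (`valve_induction`), the shells below it are envelope-bounded, and the weight-10 norm stays bounded.  MODEL lattice only.
[cite: Tao2016AveragedNS, §4 (4.3), Lemma 4.1 (4.5); BarbatoMorandinRomito2011, §3.1] -/
theorem everyShellFires : ∀ ε₀ : ℝ, 0 < ε₀ → ∀ R : ℝ, 1 ≤ R →
    ∀ (α : Fin 4 → Fin 4 → Fin 4 → ℤ × ℤ × ℤ → ℝ),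
    Literature.Analysis.FluidPDE.TaoCascade.InTableClass R α →
    ∃ c₀ : ℝ, 0 < c₀ ∧ ∀ (X₀ : Fin 4 → ℝ) (ν T C : ℝ) (X : Fin 4 → ℤ → ℝ → ℝ), 0 < ν → 0 < T →
    (∀ i n, ContDiffOn ℝ 1 (X i n) (Set.Ico 0 T)) →
    (∀ i n, X i n 0 = if n = 0 then X₀ i else 0) →
    (∀ i n t, n < 0 → X i n t = 0) →
    (∀ i n t, 0 ≤ t → t < T → derivWithin (X i n) (Set.Ici 0) t =
      Literature.Analysis.FluidPDE.TaoCascade.quadTerm ε₀ α X i n t - ν * (1 + ε₀) ^ ((2 : ℝ) * n) * X i n t) →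
    (∀ T' : ℝ, 0 < T' → T' < T → ∃ M : ℝ, ∀ t : ℝ, 0 ≤ t → t ≤ T' →
      ∀ (i : Fin 4) (n : ℤ), (1 + (1 + ε₀) ^ ((10 : ℝ) * n)) * |X i n t| ≤ M) →
    (∀ M : ℝ, ∃ t : ℝ, 0 ≤ t ∧ t < T ∧
      ∃ (i : Fin 4) (n : ℤ), M < (1 + (1 + ε₀) ^ ((10 : ℝ) * n)) * |X i n t|) →
    (∀ (n : ℤ) (t : ℝ), 0 ≤ t → t < T →
      (1 + ε₀) ^ n * ‖Literature.Analysis.FluidPDE.TaoCascade.shellVec X n t‖ ^ 2 ≤ C) →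
    ∀ n : ℤ, 0 ≤ n → ∃ t : ℝ, 0 ≤ t ∧ t < T ∧
      c₀ * ν ^ 2 ≤ (1 + ε₀) ^ n * ‖Literature.Analysis.FluidPDE.TaoCascade.shellVec X n t‖ ^ 2 := by
  intro ε₀ hε R _hR α hα
  have hl0 : (0 : ℝ) < 1 + ε₀ := by linarith
  have hl1 : (1 : ℝ) ≤ 1 + ε₀ := by linarith
  set c₀ : ℝ := 1 / (32768 * (1 + ε₀) ^ 16) with hc₀
  have hc₀0 : 0 < c₀ := by rw [hc₀]; positivity
  refine ⟨c₀, hc₀0, ?_⟩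
  intro X₀ ν T C X hν hT hcd hinit hlow hmot hreg hblow henv n hn
  obtain ⟨n₀, rfl⟩ := Int.eq_ofNat_of_zero_le hn
  by_contra hfire
  -- shell `n₀` is a closed valve
  have hvalve : ∀ t, 0 ≤ t → t < T → (1 + ε₀) ^ n₀ * ‖shellVec X n₀ t‖ ^ 2 ≤ c₀ * ν ^ 2 := by
    intro t h0 htT
    by_contra h
    exact hfire ⟨t, h0, htT, by rw [zpow_natCast]; exact (not_le.1 h).le⟩
  have hcan : IsCancellingCoeff α := hα.2.1
  have hα1 : ∀ i₁ i₂ i₃ : Fin 4, |α i₁ i₂ i₃ (0, 0, 1)| ≤ 1 := fun i₁ i₂ i₃ =>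
    abs_le_one_of_inTableClass hα i₁ i₂ i₃ _ (by rw [mem_shiftSet_iff]; simp)
  have hP := valve_induction hε hν hT hc₀0 le_rfl hcan hα1 hcd hinit hmot hreg n₀ hvalve
  -- the envelope constant is nonnegative
  have hC0 : 0 ≤ C := le_trans (by positivity) (henv 0 0 le_rfl hT)
  -- the weight-20 bound above `n₀`
  have hup : ∀ (j : ℕ) (t : ℝ), 0 ≤ t → t < T →
      ((1 + ε₀) ^ (10 * (n₀ + j)) * ‖shellVec X ((n₀ + j : ℕ) : ℤ) t‖) ^ 2 ≤ (1 + ε₀) ^ (19 * n₀) * c₀ * ν ^ 2 := by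
    intro j t h0 htT
    have h1 := hP j t h0 htT
    have hcj : (1 + ε₀) ^ (19 * j) * (c₀ / (2 * (1 + ε₀) ^ 19) ^ j) ≤ c₀ := by
      rw [mul_pow, ← pow_mul, show 19 * j = j * 19 by ring]
      have h2 : (1 + ε₀) ^ (j * 19) * (c₀ / (2 ^ j * (1 + ε₀) ^ (j * 19))) = c₀ / 2 ^ j := by
        field_simp
      rw [h2]
      exact div_le_self hc₀0.le (one_le_pow₀ (by norm_num))
    have hv := sq_nonneg ‖shellVec X ((n₀ + j : ℕ) : ℤ) t‖
    calc ((1 + ε₀) ^ (10 * (n₀ + j)) * ‖shellVec X ((n₀ + j : ℕ) : ℤ) t‖) ^ 2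
        = (1 + ε₀) ^ (19 * n₀) * ((1 + ε₀) ^ (19 * j) *
            ((1 + ε₀) ^ (n₀ + j) * ‖shellVec X ((n₀ + j : ℕ) : ℤ) t‖ ^ 2)) := by ring
      _ ≤ (1 + ε₀) ^ (19 * n₀) * ((1 + ε₀) ^ (19 * j) * (c₀ / (2 * (1 + ε₀) ^ 19) ^ j * ν ^ 2)) := by
          gcongr
      _ = (1 + ε₀) ^ (19 * n₀) * ((1 + ε₀) ^ (19 * j) * (c₀ / (2 * (1 + ε₀) ^ 19) ^ j)) * ν ^ 2 := by ring
      _ ≤ (1 + ε₀) ^ (19 * n₀) * c₀ * ν ^ 2 := by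
          have := mul_le_mul_of_nonneg_left hcj (pow_nonneg hl0.le (19 * n₀))
          nlinarith [sq_nonneg ν]
  -- a uniform weight-10 bound, contradicting the blow-up
  set B₁ : ℝ := Real.sqrt ((1 + ε₀) ^ (19 * n₀) * c₀) * ν with hB₁
  have hB₁0 : 0 ≤ B₁ := by rw [hB₁]; positivity
  set B : ℝ := 2 * (1 + ε₀) ^ (10 * n₀) * Real.sqrt C + 2 * B₁ + 1 with hB
  obtain ⟨t, ht0, htT, i, k, hk⟩ := hblow B
  have hbound : (1 + (1 + ε₀) ^ ((10 : ℝ) * k)) * |X i k t| ≤ 2 * (1 + ε₀) ^ (10 * n₀) * Real.sqrt C + 2 * B₁ := by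
    rcases lt_or_ge k 0 with hkneg | hk0
    · rw [hlow i k t hkneg, abs_zero, mul_zero]; positivity
    · obtain ⟨k', rfl⟩ := Int.eq_ofNat_of_zero_le hk0
      have hw : (1 + ε₀) ^ ((10 : ℝ) * ((k' : ℕ) : ℤ)) = (1 + ε₀) ^ (10 * k') := by
        rw [show ((10 : ℝ) * (((k' : ℕ) : ℤ) : ℝ)) = ((10 * k' : ℕ) : ℝ) by push_cast; ring, Real.rpow_natCast]
      rw [hw]
      have habs := abs_apply_le_norm_shellVec X k' t i
      have hw1 : (1 : ℝ) ≤ (1 + ε₀) ^ (10 * k') := one_le_pow₀ hl1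
      rcases lt_or_ge k' n₀ with hlt | hge
      · -- below the valve: the envelope
        have he := henv k' t ht0 htT
        rw [zpow_natCast] at he
        have hk1 : (1 : ℝ) ≤ (1 + ε₀) ^ k' := one_le_pow₀ hl1
        have hn2 : ‖shellVec X (k' : ℤ) t‖ ^ 2 ≤ C := by nlinarith [sq_nonneg ‖shellVec X (k' : ℤ) t‖]
        have hnC : ‖shellVec X (k' : ℤ) t‖ ≤ Real.sqrt C :=
          (Real.le_sqrt (norm_nonneg _) hC0).2 hn2
        have hwk : (1 + ε₀) ^ (10 * k') ≤ (1 + ε₀) ^ (10 * n₀) := pow_le_pow_right₀ hl1 (by omega)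
        have hsC : 0 ≤ Real.sqrt C := Real.sqrt_nonneg C
        calc (1 + (1 + ε₀) ^ (10 * k')) * |X i (k' : ℤ) t|
            ≤ (2 * (1 + ε₀) ^ (10 * n₀)) * Real.sqrt C :=
              mul_le_mul (by linarith) (habs.trans hnC) (abs_nonneg _) (by positivity)
          _ = 2 * (1 + ε₀) ^ (10 * n₀) * Real.sqrt C := by ring
          _ ≤ 2 * (1 + ε₀) ^ (10 * n₀) * Real.sqrt C + 2 * B₁ := by linarith
      · -- above the valve: the trapped shells
        obtain ⟨j, rfl⟩ := Nat.exists_eq_add_of_le hge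
        have hsq := hup j t ht0 htT
        have hB₁sq : B₁ ^ 2 = (1 + ε₀) ^ (19 * n₀) * c₀ * ν ^ 2 := by
          rw [hB₁, mul_pow, Real.sq_sqrt (by positivity)]
        have hle : (1 + ε₀) ^ (10 * (n₀ + j)) * ‖shellVec X ((n₀ + j : ℕ) : ℤ) t‖ ≤ B₁ :=
          (pow_le_pow_iff_left₀ (by positivity) hB₁0 two_ne_zero).1 (by rw [hB₁sq]; exact hsq)
        calc (1 + (1 + ε₀) ^ (10 * (n₀ + j))) * |X i ((n₀ + j : ℕ) : ℤ) t|
            ≤ (2 * (1 + ε₀) ^ (10 * (n₀ + j))) * ‖shellVec X ((n₀ + j : ℕ) : ℤ) t‖ :=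
              mul_le_mul (by linarith) habs (abs_nonneg _) (by positivity)
          _ = 2 * ((1 + ε₀) ^ (10 * (n₀ + j)) * ‖shellVec X ((n₀ + j : ℕ) : ℤ) t‖) := by ring
          _ ≤ 2 * B₁ := by linarith
          _ ≤ 2 * (1 + ε₀) ^ (10 * n₀) * Real.sqrt C + 2 * B₁ := by
              have : 0 ≤ 2 * (1 + ε₀) ^ (10 * n₀) * Real.sqrt C := by positivity
              linarith
  have : B ≤ 2 * (1 + ε₀) ^ (10 * n₀) * Real.sqrt C + 2 * B₁ := hk.le.trans hbound
  rw [hB] at this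
  linarith

/-- Alias under the skeleton's stub name (LINE g11-1 `stub_everyShellFires`). [folklore] -/
theorem stub_everyShellFires : ∀ ε₀ : ℝ, 0 < ε₀ → ∀ R : ℝ, 1 ≤ R →
    ∀ (α : Fin 4 → Fin 4 → Fin 4 → ℤ × ℤ × ℤ → ℝ),
    Literature.Analysis.FluidPDE.TaoCascade.InTableClass R α →
    ∃ c₀ : ℝ, 0 < c₀ ∧ ∀ (X₀ : Fin 4 → ℝ) (ν T C : ℝ) (X : Fin 4 → ℤ → ℝ → ℝ), 0 < ν → 0 < T →
    (∀ i n, ContDiffOn ℝ 1 (X i n) (Set.Ico 0 T)) →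
    (∀ i n, X i n 0 = if n = 0 then X₀ i else 0) →
    (∀ i n t, n < 0 → X i n t = 0) →
    (∀ i n t, 0 ≤ t → t < T → derivWithin (X i n) (Set.Ici 0) t =
      Literature.Analysis.FluidPDE.TaoCascade.quadTerm ε₀ α X i n t - ν * (1 + ε₀) ^ ((2 : ℝ) * n) * X i n t) →
    (∀ T' : ℝ, 0 < T' → T' < T → ∃ M : ℝ, ∀ t : ℝ, 0 ≤ t → t ≤ T' →
      ∀ (i : Fin 4) (n : ℤ), (1 + (1 + ε₀) ^ ((10 : ℝ) * n)) * |X i n t| ≤ M) →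
    (∀ M : ℝ, ∃ t : ℝ, 0 ≤ t ∧ t < T ∧
      ∃ (i : Fin 4) (n : ℤ), M < (1 + (1 + ε₀) ^ ((10 : ℝ) * n)) * |X i n t|) →
    (∀ (n : ℤ) (t : ℝ), 0 ≤ t → t < T →
      (1 + ε₀) ^ n * ‖Literature.Analysis.FluidPDE.TaoCascade.shellVec X n t‖ ^ 2 ≤ C) →
    ∀ n : ℤ, 0 ≤ n → ∃ t : ℝ, 0 ≤ t ∧ t < T ∧
      c₀ * ν ^ 2 ≤ (1 + ε₀) ^ n * ‖Literature.Analysis.FluidPDE.TaoCascade.shellVec X n t‖ ^ 2 :=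
  everyShellFires

end Summit.NavierStokesRegularity.NavierStokesRegularity.Theorems.MinimalViscousBlowup.ThresholdRay

end
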